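import Summits.ABC.ABC.Theorems.SoloBlindBakerXi
import Summits.ABC.ABC.Theorems.SoloBlindPolyABC
import HarnessLib.Audit
import HarnessLib

/-!
# The Ξ-hierarchy below abc: Baker's weaker all-places estimate, quasi-polynomial abc, and the
# Mersenne floor (solo-ABC-blind, generation 3)

Companion of `SoloBlindBakerXi` (abc ⟺ `XiLowerBound`, the abc-strength all-places estimate for
`Λ = log(a/b)`).  Baker [Baker2004, §2, p. 256] singles out two modifications of the Baker–Wüstholz
inequality that together amount to abc — (i) the archimedean `|Λ|` replaced by the all-places
quantity `Ξ`, (ii) the *product* of the heights replaced by their *sum* — and records that "in a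
slightly weaker form" the required estimate reads `log Ξ ≫ −(log v₁ + ⋯ + log vₙ) · log u`,
`u = max |uⱼ|`, for `Λ = u₁ log v₁ + ⋯ + uₙ log vₙ = log(a/b)`.

This file makes the *strength* of that weaker form a kernel fact and adds the floor of the ladder:

* `BakerWeakXiBound` — the weaker form, typed over `bakerXi`: `log Ξ(a,b) ≥ −C·log(rad a·rad b)·log log a`
  for coprime `0 < b < a`, `a ≥ 3` (here `Σ log vⱼ = log(rad a · rad b)` and `log u ≤ log log a + O(1)`).
* `QuasiPolyABC` — "quasi-polynomial abc": `log c ≤ log rad(abc) · (A + B log log c)`, i.e.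
  `c ≤ rad(abc)^{A + B log log c}`; strictly between every `PolyABC K` (`quasiPolyABC_of_polyABC`) and the
  known exponential bounds.
* `quasiPolyABC_of_bakerWeakXi` — **Baker's weaker form gives exactly quasi-polynomial abc** (with
  `A = 2`, `B = C`), not abc and not a polynomial abc: requirement (ii) with the factor `log u` kept is
  worth `c ≤ rad(abc)^{O(log log c)}`.
* `MersenneRad δ` — `rad(2ⁿ − 1) ≥ κ · 2^{δ n}` for all `n ≥ 1`; `mersenneRad_of_polyABC`:
  `PolyABC K → MersenneRad (1/K)`; `mersenneRad_of_abc`: `ABC → MersenneRad δ` for every `δ < 1`.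
  In print `MersenneRad δ` is open for every `δ > 0`: the best unconditional lower bound is
  `log rad(2ⁿ − 1) ≥ C (log n)² / log log n` (Stewart 1983; Shorey–Tijdeman, *Exponential Diophantine
  Equations* (1986), Ch. 3, Thm. 3.7 [ShoreyTijdeman1986]), while abc gives `(1 − ε) n log 2` (Murty–Wong 2002,
  cf. Stewart, Acta Math. 211 (2013), §1 [Stewart2013]).  This is the lowest rung on which the abc
  ladder `ABC → PolyABC K → MersenneRad (1/K)` is already open.

All statements are elementary consequences/reformulations; nothing here is claimed new.  Sources:
A. Baker, *Experiments on the abc-conjecture*, Publ. Math. Debrecen 65 (2004) 253–260, §2 [Baker2004];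
A. Baker, G. Wüstholz, *Logarithmic Forms and Diophantine Geometry* (2007) §3.7 [BakerWustholz2007].
-/

noncomputable section

open UniqueFactorizationMonoid Finset

namespace Summit.ABC.ABC.Theorems

open Literature.NumberTheory.DiophantineGeometry

/-! ### Statements -/

/-- **Quasi-polynomial abc**: there are constants `A, B` with
`log c ≤ log rad(abc) · (A + B · log log c)` for every abc triple with `c ≥ 3`, i.e.
`c ≤ rad(abc)^{A + B log log c}`.  Implied by every `PolyABC K` (`quasiPolyABC_of_polyABC`) and by
Baker's weaker all-places form (`quasiPolyABC_of_bakerWeakXi`); open (no bound `log c ≤ rad(abc)^{o(1)}` is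
known, cf. Stewart–Yu `log c ≪ rad^{1/3} (log rad)^3`). [cite: Baker2004, §2 (p. 256)] [status: open] -/
@[conjecture] def QuasiPolyABC : Prop :=
  ∃ A B : ℝ, ∀ x y z : ℕ, IsABCTriple x y z → 3 ≤ z →
    Real.log (z : ℝ) ≤ Real.log ((rad x y z : ℕ) : ℝ) * (A + B * Real.log (Real.log (z : ℝ)))

/-- **Baker's all-places estimate in its "slightly weaker form"** [Baker2004, §2, p. 256]:
`log Ξ ≫ −(log v₁ + ⋯ + log vₙ) log u` for `Λ = Σ uⱼ log vⱼ = log(a/b)`, `u = max |uⱼ|`, typed over the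
closed form `bakerXi a b = Ξ` of `SoloBlindBakerXi` with `Σ log vⱼ = log(rad a · rad b)` and `log u`
replaced by `log log a` (`u ≤ log a / log 2`): there is `C > 0` with
`log Ξ(a, b) ≥ −C · log(rad a · rad b) · log log a` for all coprime `0 < b < a`, `a ≥ 3`.
Open; it implies quasi-polynomial abc (`quasiPolyABC_of_bakerWeakXi`) and is implied by nothing known.
[cite: Baker2004, §2 (p. 256)] [status: open] -/
@[conjecture] def BakerWeakXiBound : Prop :=
  ∃ C : ℝ, 0 < C ∧ ∀ a b : ℕ, 0 < b → b < a → 3 ≤ a → Nat.Coprime a b →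
    -C * Real.log (((radical a : ℕ) : ℝ) * ((radical b : ℕ) : ℝ)) * Real.log (Real.log (a : ℝ))
      ≤ Real.log (bakerXi a b)

/-- **The Mersenne floor** `MersenneRad δ`: `rad(2ⁿ − 1) ≥ κ · 2^{δ n}` for some `κ > 0` and all `n ≥ 1`.
`PolyABC K` gives it with `δ = 1/K` (`mersenneRad_of_polyABC`), abc with every `δ < 1`
(`mersenneRad_of_abc`); unconditionally only `log rad(2ⁿ − 1) ≫ (log n)²/log log n` is known
(Stewart 1983, [ShoreyTijdeman1986, Ch. 3, Thm. 3.7]), so `MersenneRad δ` is open for every `δ > 0`. [folklore] -/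
def MersenneRad (δ : ℝ) : Prop :=
  ∃ κ : ℝ, 0 < κ ∧ ∀ n : ℕ, 1 ≤ n → κ * (2 : ℝ) ^ (δ * (n : ℝ)) ≤ ((radical (2 ^ n - 1) : ℕ) : ℝ)

/-! ### Elementary facts -/

/-- For an abc triple with `z ≥ 2`, `rad(xyz) ≥ 2`. [folklore] -/
theorem two_le_rad {x y z : ℕ} (h : IsABCTriple x y z) (hz : 2 ≤ z) : 2 ≤ rad x y z := by
  obtain ⟨hx, hy, hxyz, -⟩ := h
  rw [rad_def, Nat.two_le_radical_iff]
  have : 1 ≤ x * y := Nat.one_le_iff_ne_zero.mpr (Nat.mul_ne_zero (by omega) (by omega))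
  nlinarith

/-! ### Baker's weaker form ⟹ quasi-polynomial abc -/

/-- The ordered case `x ≤ y` of `quasiPolyABC_of_bakerWeakXi`. [folklore] -/
theorem log_le_of_bakerWeakXi {C : ℝ} (hC : 0 < C)
    (H : ∀ a b : ℕ, 0 < b → b < a → 3 ≤ a → Nat.Coprime a b →
      -C * Real.log (((radical a : ℕ) : ℝ) * ((radical b : ℕ) : ℝ)) * Real.log (Real.log (a : ℝ))
        ≤ Real.log (bakerXi a b))
    {x y z : ℕ} (h : IsABCTriple x y z) (hz : 3 ≤ z) (hxy : x ≤ y) :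
    Real.log (z : ℝ) ≤
      Real.log ((rad x y z : ℕ) : ℝ) * (2 + C * Real.log (Real.log (z : ℝ))) := by
  have hR2 := two_le_rad h (by omega)
  have hmul := rad_eq_mul_of_isABCTriple h
  obtain ⟨hx, hy, hxyz, hcop⟩ := h
  have hyz : y < z := by omega
  have hzy : Nat.Coprime z y := by
    rw [← hxyz]; exact Nat.coprime_add_self_left.mpr hcop
  have hz3 : (3 : ℝ) ≤ (z : ℝ) := by exact_mod_cast hz
  have hz0 : (0 : ℝ) < (z : ℝ) := by linarith
  have hy0 : (0 : ℝ) < (y : ℝ) := by exact_mod_cast hy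
  -- the radicals as reals
  set rx : ℝ := ((radical x : ℕ) : ℝ) with hrx
  set ry : ℝ := ((radical y : ℕ) : ℝ) with hry
  set rz : ℝ := ((radical z : ℕ) : ℝ) with hrz
  set R : ℝ := ((rad x y z : ℕ) : ℝ) with hRdef
  have hrx1 : (1 : ℝ) ≤ rx := by rw [hrx]; exact_mod_cast Nat.radical_pos x
  have hry1 : (1 : ℝ) ≤ ry := by rw [hry]; exact_mod_cast Nat.radical_pos y
  have hrz1 : (1 : ℝ) ≤ rz := by rw [hrz]; exact_mod_cast Nat.radical_pos z
  have hR2' : (2 : ℝ) ≤ R := by rw [hRdef]; exact_mod_cast hR2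
  have hRpos : (0 : ℝ) < R := by linarith
  -- Baker's weaker form at (a, b) = (z, y): Ξ(z, y) ≤ rad(z - y)/y = rad(x)/y
  have hH := H z y hy hyz hz hzy
  have hsub : z - y = x := by omega
  have hXi_le : bakerXi z y ≤ rx / (y : ℝ) := by
    have := bakerXi_le_radical_div hy hyz
    rwa [hsub] at this
  have hXi_pos : 0 < bakerXi z y := by
    have h1 := radical_div_le_bakerXi hy hyz
    rw [hsub] at h1
    have h2 : (0 : ℝ) < rx / (z : ℝ) := by positivity
    linarith
  have hlogXi : Real.log (bakerXi z y) ≤ Real.log rx - Real.log (y : ℝ) := by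
    rw [← Real.log_div (by positivity) hy0.ne']
    exact Real.log_le_log hXi_pos hXi_le
  -- bounds on the logarithms of the radicals
  have hLL : 0 ≤ Real.log (Real.log (z : ℝ)) := by
    -- `log log z ≥ 0` for `z ≥ 3` since `e < 3`
    apply Real.log_nonneg
    rw [Real.le_log_iff_exp_le hz0]
    have := Real.exp_one_lt_d9
    linarith
  have hlogrx : Real.log rx ≤ Real.log R := by
    apply Real.log_le_log (by positivity)
    rw [hmul]
    have : rx * 1 * 1 ≤ rx * ry * rz := by gcongr
    linarith
  have hL1 : Real.log (rz * ry) ≤ Real.log R := by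
    apply Real.log_le_log (by positivity)
    rw [hmul]
    have : 1 * ry * rz ≤ rx * ry * rz := by gcongr
    linarith
  have hL1' : 0 ≤ Real.log (rz * ry) := Real.log_nonneg (by nlinarith)
  have hlog2 : Real.log 2 ≤ Real.log R := Real.log_le_log (by norm_num) hR2'
  have hlogR0 : 0 ≤ Real.log R := Real.log_nonneg (by linarith)
  -- z ≤ 2 y
  have hz2y : (z : ℝ) ≤ 2 * (y : ℝ) := by
    have : z ≤ 2 * y := by omega
    exact_mod_cast this
  have hlogz : Real.log (z : ℝ) ≤ Real.log 2 + Real.log (y : ℝ) := by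
    rw [← Real.log_mul (by norm_num) hy0.ne']
    exact Real.log_le_log hz0 hz2y
  -- assemble
  have hprod : C * Real.log (rz * ry) * Real.log (Real.log (z : ℝ))
      ≤ C * Real.log R * Real.log (Real.log (z : ℝ)) := by
    gcongr
  nlinarith [hH, hlogXi, hlogrx, hL1, hlog2, hlogz, hprod]

/-- **Baker's weaker all-places form gives quasi-polynomial abc** (`A = 2`, `B = C`):
`log c ≤ log rad(abc) · (2 + C log log c)` for every abc triple with `c ≥ 3`. [folklore] -/
theorem quasiPolyABC_of_bakerWeakXi (hB : BakerWeakXiBound) : QuasiPolyABC := by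
  obtain ⟨C, hC, H⟩ := hB
  refine ⟨2, C, fun x y z h hz => ?_⟩
  rcases le_or_gt x y with hxy | hyx
  · exact log_le_of_bakerWeakXi hC H h hz hxy
  · obtain ⟨hx, hy, hxyz, hcop⟩ := h
    have h' : IsABCTriple y x z := ⟨hy, hx, by omega, hcop.symm⟩
    have hrad : rad y x z = rad x y z := by rw [rad_def, rad_def, mul_comm y x]
    have := log_le_of_bakerWeakXi hC H h' hz hyx.le
    rwa [hrad] at this

/-- `PolyABC K → QuasiPolyABC` (with `A = K + max(log C, 0)/log 2`, `B = 0`). [folklore] -/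
theorem quasiPolyABC_of_polyABC {K : ℝ} (hP : PolyABC K) : QuasiPolyABC := by
  have hK := polyABC_pos hP
  obtain ⟨C, hC, HC⟩ := hP
  refine ⟨K + max (Real.log C) 0 / Real.log 2, 0, fun x y z h hz => ?_⟩
  have hR2 := two_le_rad h (by omega)
  have h1 := HC x y z h
  obtain ⟨hx, hy, hxyz, -⟩ := h
  set R : ℝ := ((rad x y z : ℕ) : ℝ) with hRdef
  have hR2' : (2 : ℝ) ≤ R := by rw [hRdef]; exact_mod_cast hR2
  have hRpos : (0 : ℝ) < R := by linarith
  have hz0 : (0 : ℝ) < (z : ℝ) := by exact_mod_cast (show 0 < z by omega)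
  have hlog2 : 0 < Real.log 2 := Real.log_pos (by norm_num)
  have hlog2R : Real.log 2 ≤ Real.log R := Real.log_le_log (by norm_num) hR2'
  have hlogR0 : 0 ≤ Real.log R := by linarith
  have hlogz : Real.log (z : ℝ) ≤ Real.log C + K * Real.log R := by
    have := Real.log_le_log hz0 h1
    rwa [Real.log_mul hC.ne' (by positivity), Real.log_rpow hRpos] at this
  have hmax : Real.log C ≤ max (Real.log C) 0 := le_max_left _ _
  have hmax0 : 0 ≤ max (Real.log C) 0 := le_max_right _ _
  have hkey : max (Real.log C) 0 ≤ max (Real.log C) 0 / Real.log 2 * Real.log R := by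
    rw [div_mul_eq_mul_div, le_div_iff₀ hlog2]
    exact mul_le_mul_of_nonneg_left hlog2R hmax0
  simp only [zero_mul, add_zero]
  nlinarith [hlogz, hmax, hkey]

/-! ### The Mersenne floor -/

/-- `(1, 2ⁿ − 1, 2ⁿ)` is an abc triple for `n ≥ 1`. [folklore] -/
theorem isABCTriple_mersenne {n : ℕ} (hn : 1 ≤ n) : IsABCTriple 1 (2 ^ n - 1) (2 ^ n) := by
  have h2 : 2 ≤ 2 ^ n := by
    calc 2 = 2 ^ 1 := by norm_num
      _ ≤ 2 ^ n := Nat.pow_le_pow_right (by norm_num) hn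
  refine ⟨Nat.one_pos, by omega, by omega, Nat.coprime_one_left _⟩

/-- `rad(1 · (2ⁿ − 1) · 2ⁿ) ≤ 2 · rad(2ⁿ − 1)` (as reals) for `n ≥ 1`. [folklore] -/
theorem rad_mersenne_le {n : ℕ} (hn : 1 ≤ n) :
    ((rad 1 (2 ^ n - 1) (2 ^ n) : ℕ) : ℝ) ≤ 2 * ((radical (2 ^ n - 1) : ℕ) : ℝ) := by
  have h := rad_le_mul 1 (2 ^ n - 1) (2 ^ n)
  have h1 : radical (1 : ℕ) = 1 := radical_one
  have h2 : radical (2 ^ n : ℕ) = 2 := by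
    rw [radical_pow 2 (by omega), radical_of_prime Nat.prime_two.prime, normalize_eq]
  rw [h1, h2] at h
  push_cast at h
  linarith

/-- **`PolyABC K → MersenneRad (1/K)`**: a polynomial abc inequality `c ≤ C rad(abc)^K` forces
`rad(2ⁿ − 1) ≥ ½ C^{-1/K} · 2^{n/K}`. [folklore] -/
theorem mersenneRad_of_polyABC {K : ℝ} (hP : PolyABC K) : MersenneRad (1 / K) := by
  have hK := polyABC_pos hP
  obtain ⟨C, hC, HC⟩ := hP
  refine ⟨(1 / 2) * (1 / C) ^ (1 / K), by positivity, fun n hn => ?_⟩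
  have habc := isABCTriple_mersenne hn
  have h1 := HC _ _ _ habc
  have h2 := rad_mersenne_le hn
  set r : ℝ := ((radical (2 ^ n - 1) : ℕ) : ℝ) with hrdef
  set R : ℝ := ((rad 1 (2 ^ n - 1) (2 ^ n) : ℕ) : ℝ) with hRdef
  have hr0 : (0 : ℝ) ≤ r := by positivity
  have hR0 : (0 : ℝ) ≤ R := by positivity
  push_cast at h1
  -- 2^n / C ≤ R^K ≤ (2 r)^K
  have h3 : (2 : ℝ) ^ n * (1 / C) ≤ R ^ K := by
    rw [mul_one_div, div_le_iff₀ hC]; linarith [h1]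
  have h4 : R ^ K ≤ (2 * r) ^ K := Real.rpow_le_rpow hR0 h2 hK.le
  have h5 : ((2 : ℝ) ^ n * (1 / C)) ^ (1 / K) ≤ ((2 * r) ^ K) ^ (1 / K) :=
    Real.rpow_le_rpow (by positivity) (h3.trans h4) (by positivity)
  have h6 : ((2 * r) ^ K) ^ (1 / K) = 2 * r := by
    rw [← Real.rpow_mul (by positivity), mul_one_div_cancel hK.ne', Real.rpow_one]
  have h7 : ((2 : ℝ) ^ n * (1 / C)) ^ (1 / K) = (1 / C) ^ (1 / K) * (2 : ℝ) ^ (1 / K * (n : ℝ)) := by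
    rw [Real.mul_rpow (by positivity) (by positivity), ← Real.rpow_natCast,
      ← Real.rpow_mul (by norm_num)]
    ring_nf
  rw [h6, h7] at h5
  calc 1 / 2 * (1 / C) ^ (1 / K) * (2 : ℝ) ^ (1 / K * (n : ℝ))
      = 1 / 2 * ((1 / C) ^ (1 / K) * (2 : ℝ) ^ (1 / K * (n : ℝ))) := by ring
    _ ≤ 1 / 2 * (2 * r) := by gcongr
    _ = r := by ring

/-- **`ABC → MersenneRad δ` for every `δ < 1`** (Murty–Wong direction, elementary form). [folklore] -/
theorem mersenneRad_of_abc (habc : ABC) {δ : ℝ} (hδ0 : 0 < δ) (hδ : δ < 1) : MersenneRad δ := by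
  have hK : 1 < 1 / δ := by
    rw [lt_div_iff₀ hδ0]; linarith
  have hP := polyABC_of_abc habc hK
  have := mersenneRad_of_polyABC hP
  rwa [one_div_one_div] at this

/-- `MersenneRad δ` holds trivially for `δ ≤ 0` (so the content is `δ > 0`). [folklore] -/
theorem mersenneRad_of_nonpos {δ : ℝ} (hδ : δ ≤ 0) : MersenneRad δ := by
  refine ⟨1, one_pos, fun n hn => ?_⟩
  have hr : (1 : ℝ) ≤ ((radical (2 ^ n - 1) : ℕ) : ℝ) := by exact_mod_cast Nat.radical_pos _
  have hpow : (2 : ℝ) ^ (δ * (n : ℝ)) ≤ 1 := by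
    apply Real.rpow_le_one_of_one_le_of_nonpos (by norm_num)
    exact mul_nonpos_of_nonpos_of_nonneg hδ (by positivity)
  linarith

end Summit.ABC.ABC.Theorems
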